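import Mathlib
import Literature.Analysis.FluidPDE.VectorCalculus
import Literature.Analysis.FluidPDE.AxisymmetricEuler
import Literature.Analysis.FluidPDE.SwirlTransportProofs
import Summits.NavierStokesRegularity.NavierStokesRegularity.Theorems.ThreadingFluxAzimuthalCartanDefs
import Summits.NavierStokesRegularity.NavierStokesRegularity.Theorems.ThreadingFluxAzimuthalCartanLandauBaseTools
import HarnessLib

/-!
# Crux `PoloidalLiouville` (stmt-NavierStokesRegularity-1222, W1), crux idea «azimuthal-cartan-test» (ns-idea-15 g10, V26):
# the Lie derivative along the rotation — TILTS ARE MODE 1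

Generic brick for the «not a tilt plus a `J₃`-equivariant field» clauses of V26 (J♭ `PoiseuilleJordanMode`, V♯ `LandauVertexFlexibility`,
K♭): with the Lie derivative of a field `W` along the rotation generator `J₃ = e₂ × ·` about the centre `0`,

`lieJ3 W x := DW(x)(J₃ x) − J₃ (W x)`   (so `IsEquivariantOn U 0 J3 W ↔ ∀ x ∈ U, lieJ3 W x = 0`, `isEquivariantOn_iff_lieJ3`),

and the twin's `tilt V 0 Ω = Ω × V − DV(·)(Ω × ·)` (the infinitesimal rotation of the base `V` about the axis `Ω` through `0`):

* `cross_jacobi_e2` — `Ω × (e₂ × u) − e₂ × (Ω × u) = (Ω × e₂) × u` (Jacobi);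
* ★ `lieJ3_tilt` — for an AXISYMMETRIC base (`IsAxisymmetric V`, i.e. `V (R_θ x) = R_θ V x`) of class `C²`:
  `lieJ3 (tilt V 0 Ω) x = − tilt V 0 (J₃ Ω) x` — the tilts span a MODE-1 representation of the rotations about `e₂`
  (differentiate the infinitesimal axisymmetry `DV(x)(J₃x) = J₃ V(x)` (`IsAxisymmetric.fderiv_rotGen`) once more, use the symmetry of
  `D²V(x)` and Jacobi twice);
* `tilt_axis_eq_zero` — `tilt V 0 (t e₂) = 0` (the base is invariant under its own rotations), so `tilt V 0 Ω = tilt V 0 Ω_⊥`;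
* `lieJ3_eq_zero_of_isEquivariantOn` / consequences: if `W − tilt V 0 Ω` is `J₃`-equivariant on `U` then `lieJ3 W = −tilt V 0 (J₃ Ω)` on `U`
  (`lieJ3_of_sub_tilt_equivariant`) — the form in which J♭/V♯ consume it (their witnesses have `lieJ3 W` of mode 0 resp. mode 2, not a tilt).

Pure calculus about hypothetical/explicit steady profiles; `PoloidalLiouville` (1222) and NS regularity stay OPEN / NOT proved.
`--supports stmt-NavierStokesRegularity-1222 --as helper`; 0 kit.  [folklore]
-/

-- the summit and its single problem share the name (D-0017 nested layout)
set_option linter.dupNamespace false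

noncomputable section

open Set Function Metric
open scoped RealInnerProductSpace ContDiff Topology
open Literature.Analysis.FluidPDE

namespace Summit.NavierStokesRegularity.NavierStokesRegularity.Theorems.PoloidalLiouville.AzimuthalCartan

open Summit.NavierStokesRegularity.NavierStokesRegularity.Theorems.PoloidalLiouville.CentreJet (E3)

namespace LieTilt

/-! ### Algebra of the cross product about `e₂` -/

/-- Jacobi in the form used twice below: `Ω × (e × u) − e × (Ω × u) = (Ω × e) × u`. [folklore] -/
theorem cross_jacobi (Ω e u : E3) : cross Ω (cross e u) - cross e (cross Ω u) = cross (cross Ω e) u := by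
  ext i
  fin_cases i <;> simp [cross, crossProduct] <;> ring

/-- `J₃ v = e₂ × v`. [folklore] -/
theorem J3_apply (v : E3) : J3 v = cross (EuclideanSpace.single 2 1) v := rfl

/-- `J₃` is linear, recorded for `rw`. [folklore] -/
theorem J3_sub (v w : E3) : J3 (v - w) = J3 v - J3 w := map_sub J3 v w

/-! ### The Lie derivative along `J₃` and equivariance -/

/-- `IsEquivariantOn U 0 J3 W` unfolds to `∀ x ∈ U, DW(x)(J₃ x) − J₃ W(x) = 0`. [folklore] -/
theorem isEquivariantOn_zero_iff {U : Set E3} {W : E3 → E3} :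
    IsEquivariantOn U 0 J3 W ↔ ∀ x ∈ U, fderiv ℝ W x (J3 x) - J3 (W x) = 0 := by
  simp only [IsEquivariantOn, sub_zero, sub_eq_zero]

/-! ### Tilts of an axisymmetric base are mode 1 -/

variable {V : E3 → E3}

/-- The base is killed by its own rotation: `tilt V 0 (t e₂) x = 0` for an axisymmetric differentiable `V`
(`DV(x)(e₂ × x) = e₂ × V(x)`). [folklore] -/
theorem tilt_axis_eq_zero (hV : IsAxisymmetric V) {x : E3} (hd : DifferentiableAt ℝ V x) (t : ℝ) :
    tilt V 0 (t • (EuclideanSpace.single 2 1 : E3)) x = 0 := by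
  simp only [tilt, sub_zero]
  have h1 : cross (t • (EuclideanSpace.single 2 1 : E3)) (V x) = t • rotGen (V x) := by
    rw [← LandauBase.crossCLM_e2_apply, ← crossCLM_apply, map_smul]
    rfl
  have h2 : cross (t • (EuclideanSpace.single 2 1 : E3)) x = t • rotGen x := by
    rw [← LandauBase.crossCLM_e2_apply, ← crossCLM_apply, map_smul]
    rfl
  rw [h1, h2, map_smul, hV.fderiv_rotGen hd, sub_self]

/-- **Differentiated infinitesimal axisymmetry.**  If `V` is axisymmetric and `C²` near `x`, then for every `v`,
`D²V(x)(v)(J₃ x) + DV(x)(J₃ v) = J₃ (DV(x) v)` (differentiate `y ↦ DV(y)(J₃ y) = J₃ V(y)` at `x`). [folklore] -/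
theorem fderiv2_rotGen (hV : IsAxisymmetric V) {x : E3} (h2 : ContDiffAt ℝ 2 V x) (v : E3) :
    fderiv ℝ (fderiv ℝ V) x v (rotGen x) + fderiv ℝ V x (rotGen v) = rotGen (fderiv ℝ V x v) := by
  -- `V` is differentiable near `x`, `DV` differentiable at `x`
  have hd : ∀ᶠ y in 𝓝 x, DifferentiableAt ℝ V y := by
    have h := h2.eventually (by simp)
    filter_upwards [h] with y hy using hy.differentiableAt two_ne_zero
  have hDV : DifferentiableAt ℝ (fderiv ℝ V) x :=
    (h2.fderiv_right (m := 1) (by norm_num)).differentiableAt one_ne_zero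
  -- the identity as an eventual equality of functions near `x`
  have hid : (fun y => fderiv ℝ V y (rotGenL y)) =ᶠ[nhds x] fun y => rotGenL (V y) := by
    filter_upwards [hd] with y hy
    simp only [rotGenL_apply]
    exact hV.fderiv_rotGen hy
  -- differentiate both sides
  have hL : HasFDerivAt (fun y => fderiv ℝ V y (rotGenL y))
      ((fderiv ℝ V x).comp rotGenL + (fderiv ℝ (fderiv ℝ V) x).flip (rotGenL x)) x :=
    hDV.hasFDerivAt.clm_apply rotGenL.hasFDerivAt
  have hR : HasFDerivAt (fun y => rotGenL (V y)) (rotGenL.comp (fderiv ℝ V x)) x :=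
    rotGenL.hasFDerivAt.comp x (hd.self_of_nhds).hasFDerivAt
  have heq := (hL.congr_of_eventuallyEq hid.symm).unique hR
  have := congrArg (fun T : E3 →L[ℝ] E3 => T v) heq
  simp only [add_apply, ContinuousLinearMap.comp_apply, ContinuousLinearMap.flip_apply, rotGenL_apply] at this
  rw [add_comm] at this
  exact this

/-- **Tilts are mode 1**: for an axisymmetric base `V` of class `C²` near `x`,
`lieJ3 (tilt V 0 Ω) x = D(tilt V 0 Ω)(x)(J₃ x) − J₃ (tilt V 0 Ω x) = − tilt V 0 (J₃ Ω) x`. [folklore] -/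
theorem lieJ3_tilt (hV : IsAxisymmetric V) {x : E3} (h2 : ContDiffAt ℝ 2 V x) (Ω : E3) :
    fderiv ℝ (tilt V 0 Ω) x (J3 x) - J3 (tilt V 0 Ω x) = -(tilt V 0 (J3 Ω) x) := by
  have hd : DifferentiableAt ℝ V x := h2.differentiableAt two_ne_zero
  have hDV : DifferentiableAt ℝ (fderiv ℝ V) x :=
    (h2.fderiv_right (m := 1) (by norm_num)).differentiableAt one_ne_zero
  have hsymm : IsSymmSndFDerivAt ℝ V x := h2.isSymmSndFDerivAt (by simp)
  -- the two summands of the tilt and their derivatives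
  have hA : HasFDerivAt (fun y : E3 => cross Ω (V y)) ((crossCLM Ω).comp (fderiv ℝ V x)) x :=
    (crossCLM Ω).hasFDerivAt.comp x hd.hasFDerivAt
  have hB : HasFDerivAt (fun y : E3 => fderiv ℝ V y (cross Ω (y - 0)))
      ((fderiv ℝ V x).comp (crossCLM Ω) + (fderiv ℝ (fderiv ℝ V) x).flip (cross Ω x)) x := by
    have e : (fun y : E3 => fderiv ℝ V y (cross Ω (y - 0))) = fun y => fderiv ℝ V y (crossCLM Ω y) := by
      funext y; rw [sub_zero, crossCLM_apply]
    rw [e]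
    have h := hDV.hasFDerivAt.clm_apply (crossCLM Ω).hasFDerivAt
    simpa [crossCLM_apply] using h
  have htilt : HasFDerivAt (tilt V 0 Ω)
      ((crossCLM Ω).comp (fderiv ℝ V x) - ((fderiv ℝ V x).comp (crossCLM Ω) + (fderiv ℝ (fderiv ℝ V) x).flip (cross Ω x))) x := by
    have e : tilt V 0 Ω = fun y => cross Ω (V y) - fderiv ℝ V y (cross Ω (y - 0)) := rfl
    rw [e]
    exact hA.sub hB
  rw [htilt.fderiv]
  simp only [tilt, sub_zero, J3_apply, sub_apply, add_apply,
    ContinuousLinearMap.comp_apply, ContinuousLinearMap.flip_apply, crossCLM_apply]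
  -- ingredients: the differentiated infinitesimal axisymmetry, symmetry of `D²V`, Jacobi (twice)
  have h2' : fderiv ℝ (fderiv ℝ V) x (cross Ω x) (cross (EuclideanSpace.single 2 1) x) +
      fderiv ℝ V x (cross (EuclideanSpace.single 2 1) (cross Ω x)) =
        cross (EuclideanSpace.single 2 1) (fderiv ℝ V x (cross Ω x)) := by
    have h := fderiv2_rotGen hV h2 (cross Ω x)
    rw [← LandauBase.crossCLM_e2_apply, ← LandauBase.crossCLM_e2_apply, ← LandauBase.crossCLM_e2_apply,
      crossCLM_apply, crossCLM_apply, crossCLM_apply] at h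
    exact h
  have hsw : fderiv ℝ (fderiv ℝ V) x (cross (EuclideanSpace.single 2 1) x) (cross Ω x) =
      fderiv ℝ (fderiv ℝ V) x (cross Ω x) (cross (EuclideanSpace.single 2 1) x) := hsymm.eq _ _
  have key : fderiv ℝ (fderiv ℝ V) x (cross Ω x) (cross (EuclideanSpace.single 2 1) x) =
      cross (EuclideanSpace.single 2 1) (fderiv ℝ V x (cross Ω x)) -
        fderiv ℝ V x (cross (EuclideanSpace.single 2 1) (cross Ω x)) := eq_sub_of_add_eq h2'
  have jac1 : cross Ω (cross (EuclideanSpace.single 2 1) (V x)) =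
      cross (cross Ω (EuclideanSpace.single 2 1)) (V x) + cross (EuclideanSpace.single 2 1) (cross Ω (V x)) := by
    rw [← cross_jacobi]; abel
  have jac2 : cross Ω (cross (EuclideanSpace.single 2 1) x) =
      cross (cross Ω (EuclideanSpace.single 2 1)) x + cross (EuclideanSpace.single 2 1) (cross Ω x) := by
    rw [← cross_jacobi]; abel
  have hanti : cross (EuclideanSpace.single 2 1) Ω = -cross Ω (EuclideanSpace.single 2 1) := by
    ext i; fin_cases i <;> simp [cross, crossProduct]
  have hcneg : ∀ a b : E3, cross (-a) b = -cross a b := fun a b => by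
    rw [← crossCLM_apply, ← crossCLM_apply, map_neg, neg_apply]
  have hce : ∀ y : E3, cross (EuclideanSpace.single 2 1) y = rotGen y := fun y => by
    rw [← crossCLM_apply]; exact LandauBase.crossCLM_e2_apply y
  have h1 : fderiv ℝ V x (cross (EuclideanSpace.single 2 1) x) = cross (EuclideanSpace.single 2 1) (V x) := by
    rw [hce, hce]; exact hV.fderiv_rotGen hd
  have hcsub : ∀ a b : E3, cross (EuclideanSpace.single 2 1) (a - b) =
      cross (EuclideanSpace.single 2 1) a - cross (EuclideanSpace.single 2 1) b := fun a b => by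
    rw [← crossCLM_apply, ← crossCLM_apply, ← crossCLM_apply, map_sub]
  rw [hsw, key, h1, jac1, jac2, map_add, hanti]
  simp only [hcneg, map_neg, hcsub]
  abel

/-- **Consumer form** (J♭ / V♯ / K♭): if `W − tilt V 0 Ω` is `J₃`-equivariant about `0` on `U` (the twin's `IsEquivariantOn U 0 J3`),
`W` differentiable and the axisymmetric base `V` of class `C²` on `U`, then the Lie derivative of `W` along the rotation IS A TILT:
`DW(x)(J₃x) − J₃ W(x) = −tilt V 0 (J₃ Ω) x` on `U`.  (So a witness whose Lie derivative is not a tilt — mode 0 for J♭, mode 2 for V♯ —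
is not «tilt + equivariant».) [folklore] -/
theorem lieJ3_of_sub_tilt_equivariant (hV : IsAxisymmetric V) {U : Set E3} {W : E3 → E3} {Ω : E3}
    (hW : ∀ x ∈ U, DifferentiableAt ℝ W x) (h2 : ∀ x ∈ U, ContDiffAt ℝ 2 V x)
    (heq : IsEquivariantOn U 0 J3 (W - tilt V 0 Ω)) {x : E3} (hx : x ∈ U) :
    fderiv ℝ W x (J3 x) - J3 (W x) = -(tilt V 0 (J3 Ω) x) := by
  have h := (isEquivariantOn_zero_iff.1 heq) x hx
  have hd : DifferentiableAt ℝ V x := (h2 x hx).differentiableAt two_ne_zero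
  have hDV : DifferentiableAt ℝ (fderiv ℝ V) x :=
    ((h2 x hx).fderiv_right (m := 1) (by norm_num)).differentiableAt one_ne_zero
  have htilt : DifferentiableAt ℝ (tilt V 0 Ω) x := by
    have e : tilt V 0 Ω = fun y => cross Ω (V y) - fderiv ℝ V y (crossCLM Ω y) := by
      funext y; simp only [tilt, sub_zero, crossCLM_apply]
    rw [e]
    exact ((crossCLM Ω).differentiableAt.comp x hd).sub (hDV.clm_apply (crossCLM Ω).differentiableAt)
  rw [fderiv_sub (hW x hx) htilt, Pi.sub_apply, sub_apply, map_sub] at h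
  have ht := lieJ3_tilt hV (h2 x hx) Ω
  -- `(DW J₃x − D tilt J₃x) − (J₃W − J₃ tilt) = 0` and `D tilt J₃x − J₃ tilt = −tilt'`
  calc fderiv ℝ W x (J3 x) - J3 (W x)
      = (fderiv ℝ W x (J3 x) - fderiv ℝ (tilt V 0 Ω) x (J3 x) - (J3 (W x) - J3 (tilt V 0 Ω x))) +
          (fderiv ℝ (tilt V 0 Ω) x (J3 x) - J3 (tilt V 0 Ω x)) := by abel
    _ = -(tilt V 0 (J3 Ω) x) := by rw [h, ht, zero_add]

end LieTilt

end Summit.NavierStokesRegularity.NavierStokesRegularity.Theorems.PoloidalLiouville.AzimuthalCartan
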